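import Summits.AnomalousDissipation.AnomalousDissipation.Theses.MomentParity
import Summits.AnomalousDissipation.AnomalousDissipation.Theorems.MomentParityGalerkinEnsembleRealization
import Summits.AnomalousDissipation.AnomalousDissipation.Theorems.ResolvedDissipation.Negative.KillShape
import Summits.AnomalousDissipation.AnomalousDissipation.Theorems.MomentParityResolvedDissipationInvariance

/-!
# Stub S1 of line `lh-energy-equality-bracket`, crux `MomentParity.ResolvedDissipation`
# (stmt-AnomalousDissipation-14284): the leaking sequence in budget form

From the kill shape (a fixed `(f, ν, R, n)` and, for every cutoff `K`, an admissible law that is not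
`K`-resolved at tolerance `1/(n+1)`) to a leaking SEQUENCE: levels `N_j → ∞` and admissible laws `μ_j`
such that for every `K ≤ j` the mean resolved dissipation at cutoff `K` (coefficient form) plus the
margin `ν/(n+1)` is dominated by the mean work `∫ (u, f) dμ_j`.

* `stub_leakingSequence` — the registered stub S1 (last declaration).

Ingredients: `N_j > j` (`Negative.isResolved_const_of_level_le`, contrapositive); monotonicity of the
truncated enstrophy in the cutoff (`Negative.eGradNormSq_fourierTruncate_mono`); the energy row
`ν ∫⁻ ‖∇u‖² dμ = ∫ (u, f) dμ` (`Negative.ensembleDissipation_eq_of_isStationary`, finite by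
`Negative.ensembleEnstrophy_ne_top`); Parseval for `P_K` (`MomentParityMomentClosure.eGradNormSq_fourierTruncate_coe`).
-/

noncomputable section

set_option linter.dupNamespace false

namespace Summit.AnomalousDissipation.AnomalousDissipation.Theorems.MomentParityResolvedDissipation.LhBracket.LeakingSequence

open MeasureTheory Filter Topology Set Function Metric UnitAddTorus
open scoped ENNReal InnerProductSpace RealInnerProductSpace BigOperators
open Literature.Analysis.FunctionSpaces Literature.Analysis.FunctionSpaces.Torus
open Literature.Analysis.FluidPDE Literature.Analysis.FluidPDE.Torus
open Summit.AnomalousDissipation.AnomalousDissipation.Theses.MomentParity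
open Summit.AnomalousDissipation.AnomalousDissipation.Theorems.MomentParity
open Summit.AnomalousDissipation.AnomalousDissipation.Theorems.QuarticGate.Negative
  (IsLevel IsBandTest polyGrad IsPolyStationary)
open Summit.AnomalousDissipation.AnomalousDissipation.Theorems

/-- **The truncated enstrophy in coefficient form.** For `K ≤ N` and every `u ∈ H`,
`‖∇P_K u‖₂² = 4π² Σ_{k ∈ freqBall K} |k|² ‖(û|_{freqBall N})‾ k‖²` (Parseval for the trigonometric
polynomial `P_K u`; on `freqBall K ⊆ freqBall N` the zero-extended restricted coefficient vector is `û`).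
[folklore] -/
theorem eGradNormSq_fourierTruncate_eq_coeffExt {K N : ℕ} (hKN : K ≤ N)
    (u : Torus.energySpace (Fin 3)) :
    Torus.eGradNormSq (Torus.fourierTruncate K
        (u.1 : UnitAddTorus (Fin 3) → EuclideanSpace ℝ (Fin 3))) =
      ENNReal.ofReal (4 * Real.pi ^ 2 * ∑ k ∈ freqBall K, freqNormSq k *
        ‖coeffExt (freqBall N) (fourierRestrict (freqBall N)
          (u.1 : UnitAddTorus (Fin 3) → EuclideanSpace ℝ (Fin 3))) k‖ ^ 2) := by
  rw [MomentParityMomentClosure.eGradNormSq_fourierTruncate_coe K u]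
  refine congrArg (fun s : ℝ => ENNReal.ofReal (4 * Real.pi ^ 2 * s)) ?_
  refine Finset.sum_congr rfl fun k hk => ?_
  rw [coeffExt_of_mem _ (freqBall_mono hKN hk), fourierRestrict_apply]

/-- **Mean truncated enstrophy in coefficient form.** For `K ≤ N` and any measure `μ` on `H`,
`∫ 4π² Σ_{k ∈ freqBall K} |k|² ‖(û|_{freqBall N})‾ k‖² dμ = (∫⁻ ‖∇P_K u‖₂² dμ).toReal`
(the integrand is a nonnegative continuous function on `H`). [folklore] -/
theorem integral_bandEnstrophy_eq_toReal {K N : ℕ} (hKN : K ≤ N)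
    (μ : Measure (Torus.energySpace (Fin 3))) :
    ∫ u, (4 * Real.pi ^ 2 * ∑ k ∈ freqBall K, freqNormSq k *
        ‖coeffExt (freqBall N) (fourierRestrict (freqBall N)
          (u.1 : UnitAddTorus (Fin 3) → EuclideanSpace ℝ (Fin 3))) k‖ ^ 2) ∂μ =
      (∫⁻ u, Torus.eGradNormSq (Torus.fourierTruncate K
        ((u : Torus.energySpace (Fin 3)).1 : UnitAddTorus (Fin 3) → EuclideanSpace ℝ (Fin 3))) ∂μ).toReal := by
  have hcont : Continuous fun u : Torus.energySpace (Fin 3) =>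
      (4 * Real.pi ^ 2 * ∑ k ∈ freqBall K, freqNormSq k *
        ‖coeffExt (freqBall N) (fourierRestrict (freqBall N)
          (u.1 : UnitAddTorus (Fin 3) → EuclideanSpace ℝ (Fin 3))) k‖ ^ 2) := by
    refine continuous_const.mul (continuous_finsetSum _ fun k hk => continuous_const.mul ?_)
    simp_rw [coeffExt_of_mem _ (freqBall_mono hKN hk)]
    exact (((continuous_apply _).comp (continuous_fourierRestrict_coe N)).norm).pow 2
  rw [integral_eq_lintegral_of_nonneg_ae (Eventually.of_forall fun u => ?_) hcont.aestronglyMeasurable]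
  · simp_rw [eGradNormSq_fourierTruncate_eq_coeffExt hKN]
  · exact mul_nonneg (by positivity) (Finset.sum_nonneg fun k _ =>
      mul_nonneg (freqNormSq_nonneg k) (sq_nonneg _))

/-- **S1 · `stub_leakingSequence` — from the kill shape to a leaking sequence in budget form.**
If at `(f, ν, R, n)` every cutoff `K` admits an admissible law (probability, level-`N` carried, supported in
`‖u‖ ≤ R`, stationary at all orders) that is NOT `K`-resolved at tolerance `1/(n+1)`, then there are levels
`N_j → ∞` and admissible laws `μ_j` such that for every `K ≤ j` the mean resolved dissipation at cutoff `K`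
(coefficient form) plus the margin `ν/(n+1)` is dominated by the mean work `∫ (u, f) dμ_j`.
Proof: `(N_j, μ_j)` := the law given at cutoff `K := j`; `N_j > j` (`isResolved_const_of_level_le`,
contrapositive); for `K ≤ j`, `∫⁻ Z∘P_K ≤ ∫⁻ Z∘P_j < ∫⁻ Z - (n+1)⁻¹` (`eGradNormSq_fourierTruncate_mono`,
unresolvedness), everything finite (`ensembleEnstrophy_ne_top`); the energy row
`ν (∫⁻ Z).toReal = ∫ (u, f) dμ` (`ensembleDissipation_eq_of_isStationary`); Parseval for `P_K`
(`integral_bandEnstrophy_eq_toReal`). [folklore; FMRTTurbulence2001 Ch. IV (1.31)] -/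
theorem stub_leakingSequence :
    ∀ (ν : ℝ), 0 < ν → ∀ (f : UnitAddTorus (Fin 3) → EuclideanSpace ℝ (Fin 3)), Torus.IsSmooth f →
    ∀ (R : ℝ) (n : ℕ),
    (∀ K : ℕ, ∃ (N : ℕ) (μ : Measure (Torus.energySpace (Fin 3))), IsProbabilityMeasure μ ∧
        (∀ᵐ u ∂μ, IsLevel N u) ∧ (∀ᵐ u ∂μ, ‖u‖ ≤ R) ∧
        ResolvedDissipation.Negative.IsStationary ν f N μ ∧
        ¬ ResolvedDissipation.Negative.IsResolved (fun _ => K) μ n) →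
    ∃ (Ns : ℕ → ℕ) (μs : ℕ → Measure (Torus.energySpace (Fin 3))),
      Tendsto Ns atTop atTop ∧
      (∀ j, IsProbabilityMeasure (μs j)) ∧
      (∀ j, ∀ᵐ u ∂(μs j), IsLevel (Ns j) u) ∧
      (∀ j, ∀ᵐ u ∂(μs j), ‖u‖ ≤ R) ∧
      (∀ j, ResolvedDissipation.Negative.IsStationary ν f (Ns j) (μs j)) ∧
      ∀ j K : ℕ, K ≤ j →
        (∫ u, ν * (4 * Real.pi ^ 2 * ∑ k ∈ freqBall K, freqNormSq k *
            ‖coeffExt (freqBall (Ns j)) (fourierRestrict (freqBall (Ns j))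
              (u.1 : UnitAddTorus (Fin 3) → EuclideanSpace ℝ (Fin 3))) k‖ ^ 2) ∂(μs j))
          + ν * ((n : ℝ) + 1)⁻¹ ≤
        ∫ u, Torus.pairing u.1 f ∂(μs j) := by
  intro ν hν f hf R n hK
  choose Ns μs hprob hlev hR hstat hres using hK
  -- the unresolved laws live strictly above the cutoff
  have hlt : ∀ j, j < Ns j := fun j => by
    by_contra h
    exact hres j (ResolvedDissipation.Negative.isResolved_const_of_level_le (not_lt.1 h) (hlev j) n)
  refine ⟨Ns, μs, tendsto_atTop_mono (fun j => (hlt j).le) tendsto_id, hprob, hlev, hR, hstat, ?_⟩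
  intro j K hKj
  haveI := hprob j
  have hKN : K ≤ Ns j := hKj.trans (hlt j).le
  -- notation: `E` the mean enstrophy, `A L` the mean truncated enstrophy at cutoff `L`
  set E : ℝ≥0∞ := ∫⁻ u, Torus.eGradNormSq
    ((u : Torus.energySpace (Fin 3)).1 : UnitAddTorus (Fin 3) → EuclideanSpace ℝ (Fin 3)) ∂(μs j) with hE
  have hA : ∀ L : ℕ, L ≤ j →
      (∫⁻ u, Torus.eGradNormSq (Torus.fourierTruncate L
        ((u : Torus.energySpace (Fin 3)).1 : UnitAddTorus (Fin 3) → EuclideanSpace ℝ (Fin 3))) ∂(μs j)) +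
        ((n : ℝ≥0∞) + 1)⁻¹ < E := by
    intro L hL
    have h1 := not_le.1 (hres j)
    refine lt_of_le_of_lt ?_ h1
    gcongr with u
    exact ResolvedDissipation.Negative.eGradNormSq_fourierTruncate_mono hL
      ((Lp.memLp u.1).integrable one_le_two)
  have hEtop : E ≠ ⊤ := ResolvedDissipation.Negative.ensembleEnstrophy_ne_top (hlev j) (hR j)
  have hAK := hA K hKj
  set A : ℝ≥0∞ := ∫⁻ u, Torus.eGradNormSq (Torus.fourierTruncate K
    ((u : Torus.energySpace (Fin 3)).1 : UnitAddTorus (Fin 3) → EuclideanSpace ℝ (Fin 3))) ∂(μs j) with hAdef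
  have hAtop : A ≠ ⊤ := ne_top_of_le_ne_top hEtop (le_self_add.trans hAK.le)
  -- pass to real numbers
  have hreal : A.toReal + ((n : ℝ) + 1)⁻¹ ≤ E.toReal := by
    have h2 : (A + ((n : ℝ≥0∞) + 1)⁻¹).toReal ≤ E.toReal := ENNReal.toReal_mono hEtop hAK.le
    have h3 : (((n : ℝ≥0∞) + 1)⁻¹).toReal = ((n : ℝ) + 1)⁻¹ := by
      rw [ENNReal.toReal_inv, ENNReal.toReal_add (ENNReal.natCast_ne_top n) ENNReal.one_ne_top,
        ENNReal.toReal_natCast, ENNReal.toReal_one]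
    rwa [ENNReal.toReal_add hAtop (ENNReal.inv_ne_top.2 (by positivity)), h3] at h2
  -- the energy row
  have hrow : ν * E.toReal = ∫ u, Torus.pairing u.1 f ∂(μs j) :=
    ResolvedDissipation.Negative.ensembleDissipation_eq_of_isStationary (hf.memLp 2) (hlev j) (hR j) (hstat j)
  rw [integral_const_mul, integral_bandEnstrophy_eq_toReal hKN, ← hrow, ← hAdef, ← mul_add]
  exact mul_le_mul_of_nonneg_left hreal hν.le

end Summit.AnomalousDissipation.AnomalousDissipation.Theorems.MomentParityResolvedDissipation.LhBracket.LeakingSequence
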